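import Mathlib
import Literature.NumberTheory.LFunctions.KatkovaPF44Proofs

/-!
# K2 lane (route-2 `SawtoothPulseCascade`, crux dir `K1LocalisedCascade`): the windowed energy of a STRAIGHT sheet pair — the input-energy denominator of every far `Transfer` entry with a V source (E6 far-row schema, A27-7; sub-lemma L-i-c of `Cruxes/K1LocalisedCascade/K2FarRowsR1-p2.md` §6)

Helper file of the K2 lane (ACL item stmt-AnomalousDissipation-19491). p4's lattice state of a straight V-sheet pair with densities `d = (d₀, d₁)` of class
`(α, β)` is `Z(m, n) = d₀(n) e^{−iπ(α+m)/2} + d₁(n) e^{iπ(α+m)/2}` (`K2ConeSketch.vPairState`, copied verbatim in the crux file `K2CombColumnLaw.lean`); its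
windowed level-0 energy is `Σ_{|m|,|n| ≤ K} ‖Z(m,n)‖² / (4π²((α+m)² + (β+n)²))` (`cEnergy … 0 K (truncW K (vPairState α d))` = the `inputState` of a V source
in `Transfer`). This file proves the K-EXPLICIT TWO-SIDED COLUMN BOUNDS (class offset `α ∈ [0, 1]`, `b = β + n`)

  `(‖d₀‖²+‖d₁‖²)·(π/|b| − 2/(K+1) − 4/b²) ≤ Σ_{|m| ≤ K} ‖Z(m,n)‖²/((α+m)² + b²) ≤ (‖d₀‖²+‖d₁‖²)·(π/|b| + 4/b²)`

(`vPair_column_energy_lower` / `_upper`; lattice form `vPair_window_energy_lower`): the windowed energy of a straight pair is its full-lattice value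
`(‖d₀‖²+‖d₁‖²)/(4π|b|)` per column up to the window defect `2/(K+1)` and `O(1/b²)` — the denominator control of every far entry `M[(t′,s′) ← (V,s)]`
(sources in shell `s` have `|b| ≥ 2^{s−1}`). Ingredients: the cross term of the two sheets alternates in `m` (`e^{−iπ(α+m)}`) and an alternating sum of a
unimodal weight is `O(max weight)` (`abs_alternating_sum_range_le`, `window_weight_alternating_le`); the direct term is an antitone lattice sum compared
with `∫ dx/(x²+b²)` (`AntitoneOn.integral_le_sum`, `window_weight_sum_lower/upper`). No definitions; nothing about the crux by name. [folklore] [problem: turb]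
-/
-- `Summit.<Summit>.<Problem>`: single-conjunct summit, the duplicate namespace segment is deliberate.
set_option linter.dupNamespace false

noncomputable section

namespace Summit.AnomalousDissipation.AnomalousDissipation.Theorems.SawtoothPulseCascade.K2PhaseBudget

open Finset MeasureTheory intervalIntegral

/-- Partial sums of an alternating series with antitone nonnegative terms lie in `[0, f 0]`. [folklore] -/
theorem alternating_sum_range_mem {f : ℕ → ℝ} (hf : Antitone f) (h0 : ∀ n, 0 ≤ f n) (n : ℕ) :
    0 ≤ ∑ i ∈ range n, (-1 : ℝ) ^ i * f i ∧ ∑ i ∈ range n, (-1 : ℝ) ^ i * f i ≤ f 0 := by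
  have Q : ∀ k : ℕ, 0 ≤ ∑ i ∈ range (2 * k), (-1 : ℝ) ^ i * f i ∧ ∑ i ∈ range (2 * k + 1), (-1 : ℝ) ^ i * f i ≤ f 0 := by
    intro k
    induction k with
    | zero => simp
    | succ k ih =>
      have e1 : (-1 : ℝ) ^ (2 * k) = 1 := (even_two_mul k).neg_one_pow
      have e2 : (-1 : ℝ) ^ (2 * k + 1) = -1 := (odd_two_mul_add_one k).neg_one_pow
      have e3 : (-1 : ℝ) ^ (2 * k + 2) = 1 := by
        rw [show 2 * k + 2 = 2 * (k + 1) by ring]; exact (even_two_mul (k + 1)).neg_one_pow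
      have m1 : f (2 * k + 1) ≤ f (2 * k) := hf (by omega)
      have m2 : f (2 * k + 2) ≤ f (2 * k + 1) := hf (by omega)
      constructor
      · rw [show 2 * (k + 1) = 2 * k + 1 + 1 by ring, sum_range_succ, sum_range_succ, e1, e2]
        linarith [ih.1]
      · rw [show 2 * (k + 1) + 1 = 2 * k + 2 + 1 by ring, sum_range_succ, sum_range_succ, e2, e3]
        linarith [ih.2]
  obtain ⟨k, rfl | rfl⟩ := Nat.even_or_odd' n
  · refine ⟨(Q k).1, ?_⟩
    have h := (Q k).2
    rw [sum_range_succ, (even_two_mul k).neg_one_pow] at h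
    linarith [h0 (2 * k)]
  · refine ⟨?_, (Q k).2⟩
    have h := (Q k).1
    rw [sum_range_succ, (even_two_mul k).neg_one_pow]
    linarith [h0 (2 * k)]

/-- `|Σ_{i<n} (−1)^i f(i)| ≤ f(0)` for antitone nonnegative `f`. [folklore] -/
theorem abs_alternating_sum_range_le {f : ℕ → ℝ} (hf : Antitone f) (h0 : ∀ n, 0 ≤ f n) (n : ℕ) :
    |∑ i ∈ range n, (-1 : ℝ) ^ i * f i| ≤ f 0 := by
  exact abs_le.2 ⟨by linarith [h0 0, (alternating_sum_range_mem hf h0 n).1], (alternating_sum_range_mem hf h0 n).2⟩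

/-- `∫_{x₁}^{x₂} dx/(x²+b²) = (arctan(x₂/b) − arctan(x₁/b))/b` for `b > 0`. [folklore] -/
theorem integral_inv_sq_add_sq {b : ℝ} (hb : 0 < b) (x₁ x₂ : ℝ) :
    ∫ x in x₁..x₂, ((x ^ 2 + b ^ 2)⁻¹ : ℝ) = (Real.arctan (x₂ / b) - Real.arctan (x₁ / b)) / b := by
  have hb0 : b ≠ 0 := hb.ne'
  have hd : ∀ x ∈ Set.uIcc x₁ x₂, HasDerivAt (fun x : ℝ => Real.arctan (x / b) / b) ((x ^ 2 + b ^ 2)⁻¹) x := by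
    intro x _
    have h1 : HasDerivAt (fun x : ℝ => x / b) (1 / b) x := by simpa using (hasDerivAt_id x).div_const b
    have h2 : HasDerivAt (fun x : ℝ => Real.arctan (x / b) / b) (1 / (1 + (x / b) ^ 2) * (1 / b) / b) x := (h1.arctan).div_const b
    have hx : (1 : ℝ) + (x / b) ^ 2 ≠ 0 := by positivity
    have hx' : x ^ 2 + b ^ 2 ≠ 0 := (add_pos_of_nonneg_of_pos (sq_nonneg x) (pow_pos hb 2)).ne'
    refine h2.congr_deriv ?_
    field_simp
    ring
  have hc : Continuous fun x : ℝ => (x ^ 2 + b ^ 2)⁻¹ :=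
    ((continuous_pow 2).add continuous_const).inv₀ fun x => (add_pos_of_nonneg_of_pos (sq_nonneg x) (pow_pos hb 2)).ne'
  rw [integral_eq_sub_of_hasDerivAt hd (hc.intervalIntegrable _ _)]
  ring

/-- `Σ_{i<K} 1/((1+i)²+b²) ≥ π/(2b) − 1/(K+1) − 1/b²` for `b > 0`. [folklore] -/
theorem sum_inv_sq_add_sq_lower {b : ℝ} (hb : 0 < b) (K : ℕ) :
    Real.pi / (2 * b) - 1 / (K + 1) - 1 / b ^ 2 ≤ ∑ i ∈ range K, ((((1 : ℝ) + i) ^ 2 + b ^ 2)⁻¹ : ℝ) := by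
  have h : AntitoneOn (fun x : ℝ => (x ^ 2 + b ^ 2)⁻¹) (Set.Icc (1 : ℝ) (1 + K)) := by
    intro x hx y _ hxy
    have hx1 : (1 : ℝ) ≤ x := hx.1
    exact inv_anti₀ (by positivity) (by nlinarith)
  refine le_trans ?_ h.integral_le_sum
  rw [integral_inv_sq_add_sq hb]
  have hK : (0 : ℝ) < 1 + K := by positivity
  have h1 : Real.arctan ((1 + K) / b) = Real.pi / 2 - Real.arctan (b / (1 + K)) := by
    rw [← inv_div, Real.arctan_inv_of_pos (by positivity)]
  have h2 : Real.arctan (b / (1 + K)) ≤ b / (1 + K) := Literature.NumberTheory.LFunctions.arctan_le_self (by positivity)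
  have h3 : Real.arctan (1 / b) ≤ 1 / b := Literature.NumberTheory.LFunctions.arctan_le_self (by positivity)
  rw [h1]
  calc Real.pi / (2 * b) - 1 / (K + 1) - 1 / b ^ 2 = (Real.pi / 2 - b / (1 + K) - 1 / b) / b := by
        field_simp
        ring
    _ ≤ (Real.pi / 2 - Real.arctan (b / (1 + K)) - Real.arctan (1 / b)) / b := by
        apply div_le_div_of_nonneg_right _ hb.le
        linarith

/-- `Σ_{i<K} 1/((1+i)²+b²) ≤ π/(2b)` for `b > 0`. [folklore] -/
theorem sum_inv_sq_add_sq_upper {b : ℝ} (hb : 0 < b) (K : ℕ) :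
    ∑ i ∈ range K, ((((1 : ℝ) + i) ^ 2 + b ^ 2)⁻¹ : ℝ) ≤ Real.pi / (2 * b) := by
  have h : AntitoneOn (fun x : ℝ => (x ^ 2 + b ^ 2)⁻¹) (Set.Icc (0 : ℝ) (0 + K)) := by
    intro x hx y _ hxy
    have hx0 : (0 : ℝ) ≤ x := hx.1
    exact inv_anti₀ (by positivity) (by nlinarith)
  have h1 := h.sum_le_integral
  have h2 : ∫ x in (0 : ℝ)..0 + K, ((x ^ 2 + b ^ 2)⁻¹ : ℝ) ≤ Real.pi / (2 * b) := by
    rw [integral_inv_sq_add_sq hb, zero_div, Real.arctan_zero, sub_zero]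
    have h3 := Real.arctan_lt_pi_div_two ((0 + K) / b)
    calc Real.arctan ((0 + K) / b) / b ≤ (Real.pi / 2) / b := div_le_div_of_nonneg_right h3.le hb.le
      _ = Real.pi / (2 * b) := by rw [div_div]
  refine le_trans (le_of_eq (sum_congr rfl fun i _ => ?_)) (h1.trans h2)
  push_cast
  ring

/-- The window sum split into its two half-ranges: `Σ_{m=−K}^{K} g(m) = Σ_{i<K} g(−(i+1)) + Σ_{i<K+1} g(i)`. [folklore] -/
theorem sum_Icc_neg_nat_split {M : Type*} [AddCommMonoid M] (K : ℕ) (g : ℤ → M) :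
    ∑ m ∈ Icc (-(K : ℤ)) K, g m = ∑ i ∈ range K, g (-((i : ℤ) + 1)) + ∑ i ∈ range (K + 1), g i := by
  have hdisj : Disjoint ((range K).image fun i : ℕ => -((i : ℤ) + 1)) ((range (K + 1)).image fun i : ℕ => (i : ℤ)) := by
    rw [Finset.disjoint_left]
    intro m hm hm'
    simp only [mem_image, mem_range] at hm hm'
    obtain ⟨i, -, rfl⟩ := hm
    obtain ⟨j, -, hj⟩ := hm'
    omega
  have hunion : Icc (-(K : ℤ)) K =
      ((range K).image fun i : ℕ => -((i : ℤ) + 1)) ∪ ((range (K + 1)).image fun i : ℕ => (i : ℤ)) := by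
    ext m
    simp only [mem_Icc, mem_union, mem_image, mem_range]
    constructor
    · intro h
      by_cases hm : 0 ≤ m
      · exact Or.inr ⟨m.toNat, by omega, by omega⟩
      · exact Or.inl ⟨(-m - 1).toNat, by omega, by omega⟩
    · rintro (⟨i, hi, rfl⟩ | ⟨i, hi, rfl⟩) <;> omega
  rw [hunion, sum_union hdisj, sum_image fun i _ j _ h => by omega, sum_image fun i _ j _ h => by omega]

/-- **Lower bound of the windowed column weight sum** (class offset `α ∈ [0,1]`, `b > 0`):
`Σ_{m=−K}^{K} 1/((α+m)²+b²) ≥ π/b − 2/(K+1) − 2/b²`. [folklore] -/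
theorem window_weight_sum_lower {α : ℝ} (hα0 : 0 ≤ α) (hα1 : α ≤ 1) {b : ℝ} (hb : 0 < b) (K : ℕ) :
    Real.pi / b - 2 / (K + 1) - 2 / b ^ 2 ≤ ∑ m ∈ Icc (-(K : ℤ)) K, (((α + m) ^ 2 + b ^ 2)⁻¹ : ℝ) := by
  rw [sum_Icc_neg_nat_split K (fun m : ℤ => (((α + m) ^ 2 + b ^ 2)⁻¹ : ℝ))]
  have hS := sum_inv_sq_add_sq_lower hb K
  have h1 : ∑ i ∈ range K, ((((1 : ℝ) + i) ^ 2 + b ^ 2)⁻¹ : ℝ) ≤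
      ∑ i ∈ range K, (((α + ((-((i : ℤ) + 1) : ℤ) : ℝ)) ^ 2 + b ^ 2)⁻¹ : ℝ) := by
    refine sum_le_sum fun i _ => ?_
    have hi : (0 : ℝ) ≤ i := i.cast_nonneg
    push_cast
    exact inv_anti₀ (by positivity) (by nlinarith [mul_nonneg hα0 (by linarith : (0 : ℝ) ≤ 2 * (1 + i) - α)])
  have h2 : ∑ i ∈ range K, ((((1 : ℝ) + i) ^ 2 + b ^ 2)⁻¹ : ℝ) ≤
      ∑ i ∈ range (K + 1), (((α + ((i : ℤ) : ℝ)) ^ 2 + b ^ 2)⁻¹ : ℝ) := by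
    rw [sum_range_succ]
    have hlast : 0 ≤ (((α + ((K : ℤ) : ℝ)) ^ 2 + b ^ 2)⁻¹ : ℝ) := by positivity
    refine le_trans (sum_le_sum fun i _ => ?_) (le_add_of_nonneg_right hlast)
    have hi : (0 : ℝ) ≤ i := i.cast_nonneg
    push_cast
    exact inv_anti₀ (by positivity) (by nlinarith [mul_nonneg (by linarith : (0 : ℝ) ≤ 1 - α) (by linarith : (0 : ℝ) ≤ 1 + α + 2 * i)])
  have e : Real.pi / b = 2 * (Real.pi / (2 * b)) := by field_simp
  have r1 : (2 : ℝ) / (K + 1) = 2 * (1 / (K + 1)) := by ring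
  have r2 : (2 : ℝ) / b ^ 2 = 2 * (1 / b ^ 2) := by ring
  rw [e, r1, r2]
  linarith

/-- **Upper bound of the windowed column weight sum** (`α ∈ [0,1]`, `b > 0`): `Σ_{m=−K}^{K} 1/((α+m)²+b²) ≤ π/b + 2/b²`. [folklore] -/
theorem window_weight_sum_upper {α : ℝ} (hα0 : 0 ≤ α) (hα1 : α ≤ 1) {b : ℝ} (hb : 0 < b) (K : ℕ) :
    ∑ m ∈ Icc (-(K : ℤ)) K, (((α + m) ^ 2 + b ^ 2)⁻¹ : ℝ) ≤ Real.pi / b + 2 / b ^ 2 := by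
  rw [sum_Icc_neg_nat_split K (fun m : ℤ => (((α + m) ^ 2 + b ^ 2)⁻¹ : ℝ))]
  have hb2 : ∀ x : ℝ, ((x ^ 2 + b ^ 2)⁻¹ : ℝ) ≤ 1 / b ^ 2 := fun x => by rw [one_div]; exact inv_anti₀ (by positivity) (by nlinarith)
  have h1 : ∑ i ∈ range K, (((α + ((-((i : ℤ) + 1) : ℤ) : ℝ)) ^ 2 + b ^ 2)⁻¹ : ℝ) ≤ 1 / b ^ 2 + Real.pi / (2 * b) := by
    cases K with
    | zero => simp; positivity
    | succ K =>
      rw [sum_range_succ']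
      have hA : ∑ i ∈ range K, (((α + ((-(((i + 1 : ℕ) : ℤ) + 1) : ℤ) : ℝ)) ^ 2 + b ^ 2)⁻¹ : ℝ) ≤
          ∑ i ∈ range K, ((((1 : ℝ) + i) ^ 2 + b ^ 2)⁻¹ : ℝ) := by
        refine sum_le_sum fun i _ => ?_
        have hi : (0 : ℝ) ≤ i := i.cast_nonneg
        push_cast
        exact inv_anti₀ (by positivity) (by nlinarith [mul_nonneg (by linarith : (0 : ℝ) ≤ 1 - α) (by linarith : (0 : ℝ) ≤ 3 + 2 * i - α)])
      linarith [sum_inv_sq_add_sq_upper hb K, hb2 (α + ((-(((0 : ℕ) : ℤ) + 1) : ℤ) : ℝ))]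
  have h2 : ∑ i ∈ range (K + 1), (((α + ((i : ℤ) : ℝ)) ^ 2 + b ^ 2)⁻¹ : ℝ) ≤ 1 / b ^ 2 + Real.pi / (2 * b) := by
    rw [sum_range_succ']
    have hA : ∑ i ∈ range K, (((α + (((i + 1 : ℕ) : ℤ) : ℝ)) ^ 2 + b ^ 2)⁻¹ : ℝ) ≤
        ∑ i ∈ range K, ((((1 : ℝ) + i) ^ 2 + b ^ 2)⁻¹ : ℝ) := by
      refine sum_le_sum fun i _ => ?_
      have hi : (0 : ℝ) ≤ i := i.cast_nonneg
      push_cast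
      exact inv_anti₀ (by positivity) (by nlinarith [mul_nonneg hα0 (by linarith : (0 : ℝ) ≤ α + 2 + 2 * i)])
    linarith [sum_inv_sq_add_sq_upper hb K, hb2 (α + (((0 : ℕ) : ℤ) : ℝ))]
  have e : Real.pi / b = 2 * (Real.pi / (2 * b)) := by field_simp
  have r2 : (2 : ℝ) / b ^ 2 = 2 * (1 / b ^ 2) := by ring
  rw [e, r2]
  linarith

/-- `e^{−iπ(α+i)} = e^{−iπα}·(−1)^i` for a natural `i`. [folklore] -/
theorem exp_neg_pi_add_nat_mul_I (α : ℝ) (i : ℕ) :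
    Complex.exp (-((Real.pi * (α + i) : ℝ) : ℂ) * Complex.I) = Complex.exp (-((Real.pi * α : ℝ) : ℂ) * Complex.I) * (-1) ^ i := by
  have h : -((Real.pi * (α + i) : ℝ) : ℂ) * Complex.I = -((Real.pi * α : ℝ) : ℂ) * Complex.I + (i : ℂ) * (-((Real.pi : ℂ) * Complex.I)) := by
    push_cast; ring
  rw [h, Complex.exp_add, Complex.exp_nat_mul, Complex.exp_neg, Complex.exp_pi_mul_I]
  norm_num

/-- `e^{−iπ(α−(i+1))} = e^{−iπα}·(−1)^{i+1}` for a natural `i`. [folklore] -/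
theorem exp_neg_pi_sub_nat_succ_mul_I (α : ℝ) (i : ℕ) :
    Complex.exp (-((Real.pi * (α + -((i : ℝ) + 1)) : ℝ) : ℂ) * Complex.I) =
      Complex.exp (-((Real.pi * α : ℝ) : ℂ) * Complex.I) * (-1) ^ (i + 1) := by
  have h : -((Real.pi * (α + -((i : ℝ) + 1)) : ℝ) : ℂ) * Complex.I =
      -((Real.pi * α : ℝ) : ℂ) * Complex.I + ((i + 1 : ℕ) : ℂ) * ((Real.pi : ℂ) * Complex.I) := by
    push_cast; ring
  rw [h, Complex.exp_add, Complex.exp_nat_mul, Complex.exp_pi_mul_I]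

/-- **The alternating windowed weight sum is `O(1/b²)`:** `‖Σ_{m=−K}^{K} e^{−iπ(α+m)}/((α+m)²+b²)‖ ≤ 2/b²` (`α ∈ [0,1]`, `b > 0`). [folklore] -/
theorem window_weight_alternating_le {α : ℝ} (hα0 : 0 ≤ α) (hα1 : α ≤ 1) {b : ℝ} (hb : 0 < b) (K : ℕ) :
    ‖∑ m ∈ Icc (-(K : ℤ)) K, ((((α + m) ^ 2 + b ^ 2)⁻¹ : ℝ) : ℂ) * Complex.exp (-((Real.pi * (α + m) : ℝ) : ℂ) * Complex.I)‖ ≤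
      2 / b ^ 2 := by
  rw [sum_Icc_neg_nat_split K (fun m : ℤ => ((((α + m) ^ 2 + b ^ 2)⁻¹ : ℝ) : ℂ) * Complex.exp (-((Real.pi * (α + m) : ℝ) : ℂ) * Complex.I))]
  simp only [Int.cast_neg, Int.cast_add, Int.cast_natCast, Int.cast_one]
  have hu1 : ‖Complex.exp (-((Real.pi * α : ℝ) : ℂ) * Complex.I)‖ = 1 := by
    rw [← Complex.ofReal_neg, Complex.norm_exp_ofReal_mul_I]
  -- the two half-sums as real alternating sums
  set f : ℕ → ℝ := fun i => ((α + i) ^ 2 + b ^ 2)⁻¹ with hf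
  set g : ℕ → ℝ := fun i => ((α + -((i : ℝ) + 1)) ^ 2 + b ^ 2)⁻¹ with hg
  have hf_anti : Antitone f := by
    intro i j hij
    have hij' : (i : ℝ) ≤ j := by exact_mod_cast hij
    have hi : (0 : ℝ) ≤ i := i.cast_nonneg
    simp only [hf]
    exact inv_anti₀ (by positivity) (by nlinarith [mul_nonneg (by linarith : (0 : ℝ) ≤ j - i) (by linarith : (0 : ℝ) ≤ 2 * α + i + j)])
  have hg_anti : Antitone g := by
    intro i j hij
    have hij' : (i : ℝ) ≤ j := by exact_mod_cast hij
    have hi : (0 : ℝ) ≤ i := i.cast_nonneg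
    simp only [hg]
    exact inv_anti₀ (by positivity) (by nlinarith [mul_nonneg (by linarith : (0 : ℝ) ≤ j - i) (by linarith : (0 : ℝ) ≤ i + j + 2 - 2 * α)])
  have hf0 : ∀ n, 0 ≤ f n := fun n => by simp only [hf]; positivity
  have hg0 : ∀ n, 0 ≤ g n := fun n => by simp only [hg]; positivity
  have hP : ∑ i ∈ range (K + 1), ((((α + (i : ℝ)) ^ 2 + b ^ 2)⁻¹ : ℝ) : ℂ) * Complex.exp (-((Real.pi * (α + (i : ℝ)) : ℝ) : ℂ) * Complex.I) =
      Complex.exp (-((Real.pi * α : ℝ) : ℂ) * Complex.I) * ((∑ i ∈ range (K + 1), (-1 : ℝ) ^ i * f i : ℝ) : ℂ) := by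
    rw [Complex.ofReal_sum, mul_sum]
    refine sum_congr rfl fun i _ => ?_
    rw [exp_neg_pi_add_nat_mul_I, hf]
    push_cast
    ring
  have hN : ∑ i ∈ range K, ((((α + -((i : ℝ) + 1)) ^ 2 + b ^ 2)⁻¹ : ℝ) : ℂ) *
        Complex.exp (-((Real.pi * (α + -((i : ℝ) + 1)) : ℝ) : ℂ) * Complex.I) =
      Complex.exp (-((Real.pi * α : ℝ) : ℂ) * Complex.I) * ((-(∑ i ∈ range K, (-1 : ℝ) ^ i * g i) : ℝ) : ℂ) := by
    rw [← sum_neg_distrib, Complex.ofReal_sum, mul_sum]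
    refine sum_congr rfl fun i _ => ?_
    rw [exp_neg_pi_sub_nat_succ_mul_I, hg]
    push_cast
    ring
  rw [hN, hP]
  have h1 : ‖Complex.exp (-((Real.pi * α : ℝ) : ℂ) * Complex.I) * ((-(∑ i ∈ range K, (-1 : ℝ) ^ i * g i) : ℝ) : ℂ)‖ ≤ 1 / b ^ 2 := by
    rw [norm_mul, hu1, one_mul, Complex.norm_real, Real.norm_eq_abs, abs_neg]
    refine (abs_alternating_sum_range_le hg_anti hg0 K).trans ?_
    simp only [hg, one_div]
    push_cast
    exact inv_anti₀ (by positivity) (by nlinarith)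
  have h2 : ‖Complex.exp (-((Real.pi * α : ℝ) : ℂ) * Complex.I) * ((∑ i ∈ range (K + 1), (-1 : ℝ) ^ i * f i : ℝ) : ℂ)‖ ≤ 1 / b ^ 2 := by
    rw [norm_mul, hu1, one_mul, Complex.norm_real, Real.norm_eq_abs]
    refine (abs_alternating_sum_range_le hf_anti hf0 (K + 1)).trans ?_
    simp only [hf, one_div]
    push_cast
    exact inv_anti₀ (by positivity) (by nlinarith)
  calc _ ≤ ‖Complex.exp (-((Real.pi * α : ℝ) : ℂ) * Complex.I) * ((-(∑ i ∈ range K, (-1 : ℝ) ^ i * g i) : ℝ) : ℂ)‖ +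
        ‖Complex.exp (-((Real.pi * α : ℝ) : ℂ) * Complex.I) * ((∑ i ∈ range (K + 1), (-1 : ℝ) ^ i * f i : ℝ) : ℂ)‖ :=
        norm_add_le _ _
    _ ≤ 1 / b ^ 2 + 1 / b ^ 2 := add_le_add h1 h2
    _ = 2 / b ^ 2 := by ring

/-- `e^{−ir}·conj(e^{ir}) = e^{−2ir}` for real `r`. [folklore] -/
theorem exp_neg_mul_conj_exp (r : ℝ) :
    Complex.exp (-(r : ℝ) * Complex.I) * (starRingEnd ℂ) (Complex.exp ((r : ℝ) * Complex.I)) = Complex.exp (-(2 * r : ℝ) * Complex.I) := by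
  rw [← Complex.exp_conj, map_mul, Complex.conj_ofReal, Complex.conj_I, ← Complex.exp_add]
  congr 1
  push_cast
  ring

/-- **The squared modulus of one lattice coefficient of a straight pair:**
`‖d₀e^{−ir} + d₁e^{ir}‖² = ‖d₀‖² + ‖d₁‖² + 2 Re(d₀ d̄₁ e^{−2ir})`. [folklore] -/
theorem norm_sq_pair_coeff (d₀ d₁ : ℂ) (r : ℝ) :
    ‖d₀ * Complex.exp (-(r : ℝ) * Complex.I) + d₁ * Complex.exp ((r : ℝ) * Complex.I)‖ ^ 2 =
      ‖d₀‖ ^ 2 + ‖d₁‖ ^ 2 + 2 * (d₀ * (starRingEnd ℂ) d₁ * Complex.exp (-(2 * r : ℝ) * Complex.I)).re := by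
  have e1 : ‖Complex.exp (-(r : ℝ) * Complex.I)‖ = 1 := by
    rw [← Complex.ofReal_neg, Complex.norm_exp_ofReal_mul_I]
  have e2 : ‖Complex.exp ((r : ℝ) * Complex.I)‖ = 1 := Complex.norm_exp_ofReal_mul_I r
  rw [← Complex.normSq_eq_norm_sq, Complex.normSq_add, Complex.normSq_eq_norm_sq, Complex.normSq_eq_norm_sq, norm_mul, norm_mul, e1, e2,
    mul_one, mul_one, map_mul, ← exp_neg_mul_conj_exp r]
  congr 2
  ring

/-- **The windowed column energy of a straight pair, expanded** (`D = ‖d₀‖²+‖d₁‖²`, `P = d₀d̄₁`):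
`Σ_{m=−K}^{K} ‖d₀e^{−iπ(α+m)/2} + d₁e^{iπ(α+m)/2}‖²/((α+m)²+c²) = D·Σ_m 1/((α+m)²+c²) + 2 Re(P·Σ_m e^{−iπ(α+m)}/((α+m)²+c²))`. [folklore] -/
theorem vPair_column_energy_eq (α c : ℝ) (K : ℕ) (d₀ d₁ : ℂ) :
    ∑ m ∈ Icc (-(K : ℤ)) K, ‖d₀ * Complex.exp (-(Real.pi * (α + m) / 2 : ℝ) * Complex.I) +
        d₁ * Complex.exp ((Real.pi * (α + m) / 2 : ℝ) * Complex.I)‖ ^ 2 / ((α + m) ^ 2 + c ^ 2) =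
      (‖d₀‖ ^ 2 + ‖d₁‖ ^ 2) * ∑ m ∈ Icc (-(K : ℤ)) K, (((α + m) ^ 2 + c ^ 2)⁻¹ : ℝ) +
        2 * (d₀ * (starRingEnd ℂ) d₁ * ∑ m ∈ Icc (-(K : ℤ)) K, ((((α + m) ^ 2 + c ^ 2)⁻¹ : ℝ) : ℂ) *
          Complex.exp (-((Real.pi * (α + m) : ℝ) : ℂ) * Complex.I)).re := by
  rw [mul_sum, mul_sum, Complex.re_sum, mul_sum, ← sum_add_distrib]
  refine sum_congr rfl fun m _ => ?_
  rw [norm_sq_pair_coeff, show (2 * (Real.pi * (α + m) / 2) : ℝ) = Real.pi * (α + m) by ring, add_div, div_eq_mul_inv]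
  congr 1
  rw [show d₀ * (starRingEnd ℂ) d₁ * (((((α + m) ^ 2 + c ^ 2)⁻¹ : ℝ) : ℂ) * Complex.exp (-((Real.pi * (α + m) : ℝ) : ℂ) * Complex.I)) =
      ((((α + m) ^ 2 + c ^ 2)⁻¹ : ℝ) : ℂ) * (d₀ * (starRingEnd ℂ) d₁ * Complex.exp (-((Real.pi * (α + m) : ℝ) : ℂ) * Complex.I)) by ring,
    Complex.re_ofReal_mul]
  ring

/-- **L-i-c, ONE COLUMN.** For a class offset `α ∈ [0,1]`, any `b` (the column's `β + n`), any truncation `K` and sheet densities `d₀, d₁`: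
`(‖d₀‖² + ‖d₁‖²)·(π/|b| − 2/(K+1) − 4/b²) ≤ Σ_{m=−K}^{K} ‖d₀e^{−iπ(α+m)/2} + d₁e^{iπ(α+m)/2}‖²/((α+m)² + b²)` — the windowed column energy
(times `4π²`) of p4's `vPairState` is at least its full-lattice value `(‖d₀‖²+‖d₁‖²)·π/|b|` up to the window defect and `O(1/b²)`. (For `b = 0` the
left side is `≤ 0`, Lean's `x/0 = 0`.) [folklore] -/
theorem vPair_column_energy_lower {α : ℝ} (hα0 : 0 ≤ α) (hα1 : α ≤ 1) (b : ℝ) (K : ℕ) (d₀ d₁ : ℂ) :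
    (‖d₀‖ ^ 2 + ‖d₁‖ ^ 2) * (Real.pi / |b| - 2 / (K + 1) - 4 / b ^ 2) ≤
      ∑ m ∈ Icc (-(K : ℤ)) K, ‖d₀ * Complex.exp (-(Real.pi * (α + m) / 2 : ℝ) * Complex.I) +
        d₁ * Complex.exp ((Real.pi * (α + m) / 2 : ℝ) * Complex.I)‖ ^ 2 / ((α + m) ^ 2 + b ^ 2) := by
  set D := ‖d₀‖ ^ 2 + ‖d₁‖ ^ 2 with hD
  have hD0 : 0 ≤ D := by positivity
  rcases eq_or_ne b 0 with rfl | hb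
  · have hR0 : 0 ≤ ∑ m ∈ Icc (-(K : ℤ)) K, ‖d₀ * Complex.exp (-(Real.pi * (α + m) / 2 : ℝ) * Complex.I) +
        d₁ * Complex.exp ((Real.pi * (α + m) / 2 : ℝ) * Complex.I)‖ ^ 2 / ((α + m) ^ 2 + (0 : ℝ) ^ 2) :=
      sum_nonneg fun m _ => by positivity
    have e : D * (Real.pi / |(0 : ℝ)| - 2 / (K + 1) - 4 / (0 : ℝ) ^ 2) = -(D * (2 / (K + 1))) := by simp
    rw [e]
    have : 0 ≤ D * (2 / (K + 1)) := by positivity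
    linarith
  have hc0 : 0 < |b| := abs_pos.2 hb
  rw [← sq_abs b]
  set c := |b| with hc
  have hWl := window_weight_sum_lower hα0 hα1 hc0 K
  have hSl := window_weight_alternating_le hα0 hα1 hc0 K
  rw [vPair_column_energy_eq α c K d₀ d₁]
  set S : ℂ := ∑ m ∈ Icc (-(K : ℤ)) K, ((((α + m) ^ 2 + c ^ 2)⁻¹ : ℝ) : ℂ) * Complex.exp (-((Real.pi * (α + m) : ℝ) : ℂ) * Complex.I) with hS
  have hre := (abs_le.1 (Complex.abs_re_le_norm (d₀ * (starRingEnd ℂ) d₁ * S))).1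
  rw [norm_mul, norm_mul, Complex.norm_conj] at hre
  have h2 : 2 * (‖d₀‖ * ‖d₁‖) ≤ D := by rw [hD]; nlinarith [sq_nonneg (‖d₀‖ - ‖d₁‖)]
  have hPS : ‖d₀‖ * ‖d₁‖ * ‖S‖ ≤ ‖d₀‖ * ‖d₁‖ * (2 / c ^ 2) := mul_le_mul_of_nonneg_left hSl (by positivity)
  have a1 := mul_le_mul_of_nonneg_left hWl hD0
  have a2 := mul_le_mul_of_nonneg_right h2 (by positivity : (0 : ℝ) ≤ 2 / c ^ 2)
  have e : D * (Real.pi / c - 2 / (K + 1) - 4 / c ^ 2) = D * (Real.pi / c - 2 / (K + 1) - 2 / c ^ 2) - D * (2 / c ^ 2) := by ring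
  rw [e]
  nlinarith

/-- **L-i-c, ONE COLUMN, upper side** (`b ≠ 0`): `Σ_{m=−K}^{K} ‖d₀e^{−iπ(α+m)/2} + d₁e^{iπ(α+m)/2}‖²/((α+m)² + b²) ≤ (‖d₀‖²+‖d₁‖²)(π/|b| + 4/b²)`. [folklore] -/
theorem vPair_column_energy_upper {α : ℝ} (hα0 : 0 ≤ α) (hα1 : α ≤ 1) {b : ℝ} (hb : b ≠ 0) (K : ℕ) (d₀ d₁ : ℂ) :
    ∑ m ∈ Icc (-(K : ℤ)) K, ‖d₀ * Complex.exp (-(Real.pi * (α + m) / 2 : ℝ) * Complex.I) +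
        d₁ * Complex.exp ((Real.pi * (α + m) / 2 : ℝ) * Complex.I)‖ ^ 2 / ((α + m) ^ 2 + b ^ 2) ≤
      (‖d₀‖ ^ 2 + ‖d₁‖ ^ 2) * (Real.pi / |b| + 4 / b ^ 2) := by
  set D := ‖d₀‖ ^ 2 + ‖d₁‖ ^ 2 with hD
  have hD0 : 0 ≤ D := by positivity
  have hc0 : 0 < |b| := abs_pos.2 hb
  rw [← sq_abs b]
  set c := |b| with hc
  have hWu := window_weight_sum_upper hα0 hα1 hc0 K
  have hSl := window_weight_alternating_le hα0 hα1 hc0 K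
  rw [vPair_column_energy_eq α c K d₀ d₁]
  set S : ℂ := ∑ m ∈ Icc (-(K : ℤ)) K, ((((α + m) ^ 2 + c ^ 2)⁻¹ : ℝ) : ℂ) * Complex.exp (-((Real.pi * (α + m) : ℝ) : ℂ) * Complex.I) with hS
  have hre := (abs_le.1 (Complex.abs_re_le_norm (d₀ * (starRingEnd ℂ) d₁ * S))).2
  rw [norm_mul, norm_mul, Complex.norm_conj] at hre
  have h2 : 2 * (‖d₀‖ * ‖d₁‖) ≤ D := by rw [hD]; nlinarith [sq_nonneg (‖d₀‖ - ‖d₁‖)]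
  have hPS : ‖d₀‖ * ‖d₁‖ * ‖S‖ ≤ ‖d₀‖ * ‖d₁‖ * (2 / c ^ 2) := mul_le_mul_of_nonneg_left hSl (by positivity)
  have a1 := mul_le_mul_of_nonneg_left hWu hD0
  have a2 := mul_le_mul_of_nonneg_right h2 (by positivity : (0 : ℝ) ≤ 2 / c ^ 2)
  have e : D * (Real.pi / c + 4 / c ^ 2) = D * (Real.pi / c + 2 / c ^ 2) + D * (2 / c ^ 2) := by ring
  rw [e]
  nlinarith

/-- **L-i-c, THE LATTICE FORM** (the `inputState` energy of a V source in p4's `Transfer`, class `(α, β)` with `α ∈ [0,1]`, truncation `K`):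
`Σ_{|m|,|n| ≤ K} ‖Z(m,n)‖²/(4π²((α+m)²+(β+n)²)) ≥ (1/4π²)·Σ_{|n| ≤ K} (‖d₀(n)‖²+‖d₁(n)‖²)·(π/|β+n| − 2/(K+1) − 4/(β+n)²)`,
`Z(m,n) = d₀(n)e^{−iπ(α+m)/2} + d₁(n)e^{iπ(α+m)/2}`: every column in shell `s` (`|β+n| ≥ 2^{s−1}`) carries at least `(1 − (2/π)(2^{s−1}/(K+1)) − 8/(π 2^{s}))`
of its full-lattice energy `(‖d₀‖²+‖d₁‖²)/(4π|β+n|)`. [folklore] -/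
theorem vPair_window_energy_lower {α : ℝ} (hα0 : 0 ≤ α) (hα1 : α ≤ 1) (β : ℝ) (K : ℕ) (d : ℤ → Fin 2 → ℂ) :
    (∑ n ∈ Icc (-(K : ℤ)) K, (‖d n 0‖ ^ 2 + ‖d n 1‖ ^ 2) * (Real.pi / |β + n| - 2 / (K + 1) - 4 / (β + n) ^ 2)) / (4 * Real.pi ^ 2) ≤
      ∑ m ∈ Icc (-(K : ℤ)) K, ∑ n ∈ Icc (-(K : ℤ)) K,
        ‖d n 0 * Complex.exp (-(Real.pi * (α + m) / 2 : ℝ) * Complex.I) + d n 1 * Complex.exp ((Real.pi * (α + m) / 2 : ℝ) * Complex.I)‖ ^ 2 /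
          (4 * Real.pi ^ 2 * ((α + m) ^ 2 + (β + n) ^ 2)) := by
  rw [sum_comm, sum_div]
  refine sum_le_sum fun n _ => ?_
  have h := vPair_column_energy_lower hα0 hα1 (β + n) K (d n 0) (d n 1)
  have e : ∑ m ∈ Icc (-(K : ℤ)) K, ‖d n 0 * Complex.exp (-(Real.pi * (α + m) / 2 : ℝ) * Complex.I) +
        d n 1 * Complex.exp ((Real.pi * (α + m) / 2 : ℝ) * Complex.I)‖ ^ 2 / (4 * Real.pi ^ 2 * ((α + m) ^ 2 + (β + n) ^ 2)) =
      (∑ m ∈ Icc (-(K : ℤ)) K, ‖d n 0 * Complex.exp (-(Real.pi * (α + m) / 2 : ℝ) * Complex.I) +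
        d n 1 * Complex.exp ((Real.pi * (α + m) / 2 : ℝ) * Complex.I)‖ ^ 2 / ((α + m) ^ 2 + (β + n) ^ 2)) / (4 * Real.pi ^ 2) := by
    rw [sum_div]
    refine sum_congr rfl fun m _ => ?_
    rw [div_div, mul_comm ((α + (m : ℝ)) ^ 2 + (β + (n : ℝ)) ^ 2) (4 * Real.pi ^ 2)]
  rw [e]
  exact div_le_div_of_nonneg_right h (by positivity)

end Summit.AnomalousDissipation.AnomalousDissipation.Theorems.SawtoothPulseCascade.K2PhaseBudget
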